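import Summits.CriticalPhenomena.PercolationContinuityZ3.Theorems.PercNearOneGluingNoHeavyPcintKernZ4S5Defs
import HarnessLib

/-!
# PCINT lane, kernel check 3/4 of the B2r window certificate `d = 4`, memory 5 (4-step windows, 4096 codes): codes `2048 ≤ c < 3072`

Cell `prim-pcint`, seat `prim-pcint-2` (gen 2).  Collatz–Wielandt rows `10^5 · row ≤ 99999 · DEN · v` for the window codes in
`[2048, 3072)`, by `decide +kernel` in chunks of `128` codes (natural-number arithmetic only; `maxHeartbeats 0`).
Does NOT build on p205010.
-/

namespace Summit.CriticalPhenomena.PercolationContinuityZ3.Theorems.Pcint.Z4S5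

set_option maxHeartbeats 0 in
/-- Rows `2048 ≤ c < 2176` of the certificate hold. [folklore] -/
theorem chk_2048_2176 : chk 2048 2176 = true := by decide +kernel

set_option maxHeartbeats 0 in
/-- Rows `2176 ≤ c < 2304` of the certificate hold. [folklore] -/
theorem chk_2176_2304 : chk 2176 2304 = true := by decide +kernel

set_option maxHeartbeats 0 in
/-- Rows `2304 ≤ c < 2432` of the certificate hold. [folklore] -/
theorem chk_2304_2432 : chk 2304 2432 = true := by decide +kernel

set_option maxHeartbeats 0 in
/-- Rows `2432 ≤ c < 2560` of the certificate hold. [folklore] -/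
theorem chk_2432_2560 : chk 2432 2560 = true := by decide +kernel

set_option maxHeartbeats 0 in
/-- Rows `2560 ≤ c < 2688` of the certificate hold. [folklore] -/
theorem chk_2560_2688 : chk 2560 2688 = true := by decide +kernel

set_option maxHeartbeats 0 in
/-- Rows `2688 ≤ c < 2816` of the certificate hold. [folklore] -/
theorem chk_2688_2816 : chk 2688 2816 = true := by decide +kernel

set_option maxHeartbeats 0 in
/-- Rows `2816 ≤ c < 2944` of the certificate hold. [folklore] -/
theorem chk_2816_2944 : chk 2816 2944 = true := by decide +kernel

set_option maxHeartbeats 0 in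
/-- Rows `2944 ≤ c < 3072` of the certificate hold. [folklore] -/
theorem chk_2944_3072 : chk 2944 3072 = true := by decide +kernel

/-- Rows `2048 ≤ c < 3072` of the certificate hold. [folklore] -/
theorem chkFile_3 : chk 2048 3072 = true :=
  chk_split (chk_split (chk_split (chk_split (chk_split (chk_split (chk_split chk_2048_2176 chk_2176_2304) chk_2304_2432) chk_2432_2560) chk_2560_2688) chk_2688_2816) chk_2816_2944) chk_2944_3072

end Summit.CriticalPhenomena.PercolationContinuityZ3.Theorems.Pcint.Z4S5
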